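import Literature.AlgebraicGeometry.Resolution.ToricUniformization
import Mathlib.GroupTheory.Index
import HarnessLib

/-!
# Invariants of a finitely generated Abhyankar valued field: `|K^×|` is a lattice and `K̃/k` is finitely generated (Temkin 2013, Remark 2.1.3)

Topic: `Literature/AlgebraicGeometry/Resolution`. A PROVED leaf below the named fact `Temkin2013`
(`LocalUniformization.lean`; M. Temkin, *Inseparable local uniformization*, J. Algebra 373 (2013)
65–119 = arXiv:0804.1554v3, Thm. 1.3.2), on the branch of Abhyankar valuations (Thm. 5.5.2):
**Remark 2.1.3** of the source (p. 10: "Let `l/k` be a finitely generated Abhyankar extension.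
Then one easily sees that `l̃` is a finitely generated extension of `k̃` of transcendence degree
`F` and `|l^×|/|k^×|` is a finitely generated group whose torsion is contained in
`(|k^×| ⊗_ℤ ℚ)/|k^×|`. In particular, if `|k^×|` is divisible (for example, trivial) then
`|l^×|/|k^×|` is a lattice of rank `E`"), for a trivially valued ground field `k` — the two
finiteness statements that §5 of the source uses throughout (§5.3, p. 55: "`Λ := |K^×|` is a
"multiplicative" lattice", so that Thm. A.2.1 = `PerronTransforms.lean` applies to it; proof
of Thm. 5.5.1, p. 59: "`K̃` is separable over `k` and hence admits a separating transcendence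
basis", which needs `K̃/k` finitely generated), together with the classical ingredients of the
"easy" proof: the value group and the residue field of the Gauss valuation on `k(B)`
(Knaf–Kuhlmann 2005, Thm. 2.1: "`vK(x, y) = vK ⊕ ⊕ᵢ ℤ v(xᵢ)`", "`K(x, y)P = KP(yP)`") and the
two halves `e ≤ n`, `f ≤ n` of the fundamental inequality `ef ≤ n` for the finite extension
`K/k(B)` (Temkin 2013, §2.1, p. 9: "An easy classical result states that `ef ≤ n`"; the
product form, for an arbitrary subfield, is `FundamentalInequality.lean` — here only the two
separate bounds, in the `IntermediateField k K` framing of this file, are needed).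

Abhyankar systems `B = x ⊔ y` (`y` in `K°` with algebraically independent residues, `x ≠ 0`
with `ℤ`-independent values) are as in `TranscendenceDefect.lean` and `ToricUniformization.lean`.

## Content (everything PROVED)

* `group_fg_of_fg_of_finiteIndex` — a group with a finitely generated subgroup of finite index
  is finitely generated.
* `mk0_valuation_mem_closure_of_mem_adjoin` — `|k(B)^×| = Λ_B`: values of non-zero elements of
  `k(B)` lie in the subgroup generated by the `|xⱼ|`; `residue_mem_adjoin_of_mem_chart`,
  `residue_mem_adjoin_of_mem_adjoin` — `(k(B))~ = k(ȳ)`: residues of elements of `k(B) ∩ K°` lie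
  in `k(ȳ)` (via a toric chart containing the element, `exists_regular_toricChart`).
* `centreIdeal_adjoin_eq_span` — **Lemma 5.3.1**: the centre of `K°` on a toric chart
  `k[z, y]` (`y` with algebraically independent residues, `|zᵢ| < 1`) is the ideal `(z₁, …, z_N)`
  ("`O_{B,M}` equals to the localization of the ring `k(B_F)[M^B]` along the ideal generated by
  `M^B`").
* `card_le_finrank_of_pairwise_notMem`, `finiteIndex_of_forall_mk0_valuation_mem` — value half
  of the fundamental inequality: for `K/F` finite, the values of `F^×` generate a subgroup of
  index `≤ [K : F]` in `|K^×|`; `card_le_finrank_of_residue_linearIndependent'` — residue half: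
  elements of `K°` with residues linearly independent over a subfield of `K̃` containing the
  residues of `F ∩ K°` number at most `[K : F]`.
* `finiteDimensional_adjoin_of_isTranscendenceBasis` — `K` is finite over `k(B)` for a
  transcendence basis `B` of the finitely generated `K/k`;
  `exists_linearIndependent_valuation_of_ratRank_eq` — `E` elements with `ℤ`-independent values.
* `valueGroup_fg_of_isTranscendenceBasis`, `valueGroup_fg_of_transcendenceDefect_eq_zero`,
  `valueGroup_lattice_of_transcendenceDefect_eq_zero` — **Remark 2.1.3, value group**: for
  `K/k` finitely generated with `k ⊆ K°` and `D_{K/k} = 0`, `|K^×|` is finitely generated, a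
  free `ℤ`-module of finite rank `= ratRank O = E`.
* `residueField_fg_of_isTranscendenceBasis`, `residueField_fg_of_transcendenceDefect_eq_zero` —
  **Remark 2.1.3, residue field**: under the same hypotheses `K̃` is finite over `k(ȳ)` and a
  finitely generated extension of `k` (of transcendence degree `F = residueTrdeg` by definition).

## Sources

* M. Temkin, *Inseparable local uniformization*, J. Algebra 373 (2013) 65–119 =
  arXiv:0804.1554v3: §2.1 (pp. 9–10), Remark 2.1.3 (p. 10), §5.3 and Lemma 5.3.1 (p. 55), proof
  of Thm. 5.5.1 (p. 59).
* H. Knaf, F.-V. Kuhlmann, *Abhyankar places admit local uniformization in any characteristic*,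
  Ann. Sci. ENS 38 (2005) = arXiv:math/0304159: Thm. 2.1 and (2), p. 6.

## Rendering notes

* As in the companion files: `O = K°` a `ValuationSubring`, `k ⊆ K°` via `[Algebra k O]
  [IsScalarTower k O K]` or via `hk : ∀ c, algebraMap k K c ∈ O` with `algebraOfMem`
  (`TranscendenceDefect.lean`); the value group `|K^×|` ↦ the units `(ValueGroup O)ˣ` of
  Mathlib's value group with zero, values of non-zero elements ↦ `Units.mk0 (O.valuation _) _`;
  "`D_{K/k} = 0`" ↦ `transcendenceDefect k O hk = 0`; "lattice of rank `E`" ↦ `Module.Finite ℤ`,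
  `Module.Free ℤ` and `finrank = ratRank O` for `Additive (ValueGroup O)ˣ`; "`K̃/k` finitely
  generated" ↦ `(⊤ : IntermediateField k (ResidueField O)).FG`.
* Only the trivially valued ground field is treated (the case of the source's Thm. 1.3.2 and
  §5); the torsion statement for a non-trivially valued `k` is not rendered.
-/

noncomputable section

namespace Literature.AlgebraicGeometry.Resolution

open MvPolynomial IsLocalRing Cardinal

universe u

/-! ### Finitely generated groups: an extension of a finitely generated group by a finite set -/

section GroupFG

/-- A group with a finitely generated subgroup of finite index is finitely generated
(generators of the subgroup together with coset representatives). [folklore] -/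
theorem group_fg_of_fg_of_finiteIndex {G : Type*} [Group G] (H : Subgroup G) [H.FiniteIndex]
    (hH : H.FG) : Group.FG G := by
  classical
  obtain ⟨S, hS⟩ := hH
  haveI : Finite (G ⧸ H) := Subgroup.finite_quotient_of_finiteIndex
  haveI := Fintype.ofFinite (G ⧸ H)
  let R : Finset G := Finset.univ.image fun q : G ⧸ H => q.out
  refine Group.fg_iff.mpr ⟨(S : Set G) ∪ (R : Set G), ?_, S.finite_toSet.union R.finite_toSet⟩
  refine eq_top_iff.mpr fun g _ => ?_
  have hout : (QuotientGroup.mk g : G ⧸ H).out ∈ R :=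
    Finset.mem_image.mpr ⟨_, Finset.mem_univ _, rfl⟩
  have hrel : ((QuotientGroup.mk g : G ⧸ H).out)⁻¹ * g ∈ H := by
    rw [← QuotientGroup.eq, QuotientGroup.out_eq']
  have hg : g = (QuotientGroup.mk g : G ⧸ H).out * (((QuotientGroup.mk g : G ⧸ H).out)⁻¹ * g) := by
    rw [mul_inv_cancel_left]
  rw [hg]
  refine Subgroup.mul_mem _ (Subgroup.subset_closure (Or.inr hout)) ?_
  have hH' : H ≤ Subgroup.closure ((S : Set G) ∪ (R : Set G)) := by
    rw [← hS]
    exact Subgroup.closure_mono Set.subset_union_left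
  exact hH' hrel

end GroupFG

variable {k K : Type u} [Field k] [Field K] [Algebra k K]
variable (O : ValuationSubring K)

/-! ### Values of monomials and of elements of `k(B)` -/

section Values

/-- The unit of the value group defined by a monomial is the corresponding product of powers.
[folklore] -/
theorem mk0_valuation_prod_pow {κ : Type*} (x : κ → K) (hx0 : ∀ j, x j ≠ 0) (μ : κ →₀ ℕ) :
    Units.mk0 (O.valuation (μ.prod fun j (n : ℕ) => x j ^ n))
        (valuation_ne_zero_of_ne_zero O
          (Finset.prod_ne_zero_iff.mpr fun j _ => pow_ne_zero _ (hx0 j))) =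
      μ.prod fun j n =>
        Units.mk0 (O.valuation (x j)) (valuation_ne_zero_of_ne_zero O (hx0 j)) ^ n := by
  ext
  simp only [Finsupp.prod, map_prod, map_pow, Units.coe_prod, Units.val_pow_eq_pow_val,
    Units.val_mk0]

variable [Algebra k O] [IsScalarTower k O K] {ι κ : Type*} (y : ι → O) (x : κ → K)

/-- **`|K_B^×| = Λ_B`** (Temkin 2013, §5.3, p. 55: "The value group `Λ_B := |K_B^×|` is a
sublattice of `Λ` generated by `|B_E|`"; Knaf–Kuhlmann 2005, Thm. 2.1: "`vK(x, y) =
vK ⊕ ⊕ᵢ ℤ v(xᵢ)`"): for an Abhyankar system `B = x ⊔ y` over the trivially valued `k`, the value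
of every non-zero element of `k(B)` lies in the subgroup of the value group generated by the
values of the `xⱼ`. PROVED (dominant monomials of numerator and denominator).
[cite: Temkin2013, Section 5.3 (p. 55 of arXiv:0804.1554v3)] -/
theorem mk0_valuation_mem_closure_of_mem_adjoin (hy : AlgebraicIndependent k fun i => residue O (y i))
    (hx0 : ∀ j, x j ≠ 0)
    (hx : LinearIndependent ℤ fun j =>
      Additive.ofMul (Units.mk0 (O.valuation (x j)) (valuation_ne_zero_of_ne_zero O (hx0 j))))
    {t : K} (ht : t ∈ IntermediateField.adjoin k ((Set.range fun i => (y i : K)) ∪ Set.range x))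
    (ht0 : t ≠ 0) :
    Units.mk0 (O.valuation t) (valuation_ne_zero_of_ne_zero O ht0) ∈
      Subgroup.closure (Set.range fun j =>
        Units.mk0 (O.valuation (x j)) (valuation_ne_zero_of_ne_zero O (hx0 j))) := by
  classical
  rw [IntermediateField.mem_adjoin_iff] at ht
  obtain ⟨r, r', hrr'⟩ := ht
  have hmem : ∀ p : MvPolynomial ↥((Set.range fun i => (y i : K)) ∪ Set.range x) k,
      MvPolynomial.aeval Subtype.val p ∈
        Algebra.adjoin k ((Set.range fun i => (y i : K)) ∪ Set.range x) := fun p => by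
    have h := Algebra.adjoin_range_eq_range_aeval k
      (Subtype.val : ↥((Set.range fun i => (y i : K)) ∪ Set.range x) → K)
    rw [Subtype.range_coe] at h
    rw [h]
    exact ⟨p, rfl⟩
  obtain ⟨Qa, hQa⟩ := exists_mvPolynomial_aeval_eq O y x (hmem r)
  obtain ⟨Qb, hQb⟩ := exists_mvPolynomial_aeval_eq O y x (hmem r')
  have ha0 : aeval x Qa ≠ 0 := fun h => ht0 (by rw [hrr', ← hQa, h, zero_div])
  have hb0 : aeval x Qb ≠ 0 := fun h => ht0 (by rw [hrr', ← hQb, h, div_zero])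
  have hQa0 : Qa ≠ 0 := by
    rintro rfl
    exact ha0 (map_zero _)
  have hQb0 : Qb ≠ 0 := by
    rintro rfl
    exact hb0 (map_zero _)
  obtain ⟨μa, -, -, hva⟩ := exists_dominant_monomial O y x hy hx0 hx Qa hQa0
  obtain ⟨μb, -, -, hvb⟩ := exists_dominant_monomial O y x hy hx0 hx Qb hQb0
  have key : Units.mk0 (O.valuation t) (valuation_ne_zero_of_ne_zero O ht0) =
      (μa.prod fun j n =>
          Units.mk0 (O.valuation (x j)) (valuation_ne_zero_of_ne_zero O (hx0 j)) ^ n) *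
        (μb.prod fun j n =>
          Units.mk0 (O.valuation (x j)) (valuation_ne_zero_of_ne_zero O (hx0 j)) ^ n)⁻¹ := by
    rw [← mk0_valuation_prod_pow O x hx0 μa, ← mk0_valuation_prod_pow O x hx0 μb]
    ext
    simp only [Units.val_mul, Units.val_inv_eq_inv_val, Units.val_mk0]
    rw [hrr', ← hQa, ← hQb, map_div₀, hva, hvb, div_eq_mul_inv]
  rw [key]
  refine Subgroup.mul_mem _ ?_ (Subgroup.inv_mem _ ?_) <;>
    exact Subgroup.prod_mem _ fun j _ =>
      Subgroup.pow_mem _ (Subgroup.subset_closure (Set.mem_range_self j)) _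

end Values

/-! ### The centre of a toric chart (Temkin 2013, Lemma 5.3.1) -/

section Centre

variable [Algebra k O] [IsScalarTower k O K] {ι : Type*} (y : ι → O)

/-- **The centre of `K°` on a toric chart is generated by the monomial variables** (Temkin 2013,
Lemma 5.3.1, p. 55: "The local ring `O_{B,M}` equals to the localization of the ring
`k(B_F)[M^B]` along the ideal generated by `M^B`"; proof: "`K_B` is centered on `η_{B,M}` if and
only if `K_B°° ∩ k[M_B] = I`" with `I := M^B k[M_B]`, and "any `m ≠ 1` from `M^B` belongs to
`K°°`, and since the valuation on `k[P_B^×] ⊂ k(B_F)` is trivial we obtain that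
`K_B°° ∩ k[M_B] = I`"). Rendering, for a chart `k[z, y] ⊆ K°` with `y` of algebraically
independent residues and `z` of values `< 1` (the free monoid `M` generated by the `zᵢ`): the
centre `𝔪_{K°} ∩ k[z, y]` is the ideal `(z₁, …, z_N)`. PROVED (substituting `z := 0` in a
presentation `r = P(z, y)` changes `r` by an element of `(z)`, and the constant part
`P(0, y) ∈ k[y]` is a unit of `K°` unless it vanishes). [cite: Temkin2013, Lemma 5.3.1 (p. 55 of arXiv:0804.1554v3)] -/
theorem centreIdeal_adjoin_eq_span (hy : AlgebraicIndependent k fun i => residue O (y i))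
    {N : ℕ} (z : Fin N → K) (hz1 : ∀ i, O.valuation (z i) < 1)
    (hRO : (Algebra.adjoin k (Set.range (Sum.elim z fun i => (y i : K)))).toSubring ≤
      O.toSubring) :
    centreIdeal (Algebra.adjoin k (Set.range (Sum.elim z fun i => (y i : K)))) O hRO =
      Ideal.span (Set.range fun i => (⟨z i, Algebra.subset_adjoin ⟨Sum.inl i, rfl⟩⟩ :
        Algebra.adjoin k (Set.range (Sum.elim z fun i => (y i : K))))) := by
  classical
  set R : Subalgebra k K := Algebra.adjoin k (Set.range (Sum.elim z fun i => (y i : K))) with hR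
  -- membership in the centre is `|r| < 1`
  have hmem : ∀ r : R, r ∈ centreIdeal R O hRO ↔ O.valuation (r : K) < 1 := fun r => by
    change r ∈ Ideal.comap _ (IsLocalRing.maximalIdeal O) ↔ _
    rw [Ideal.mem_comap]
    exact ValuationSubring.valuation_lt_one_iff O _
  -- the generators, inside `R`
  let zR : Fin N → R := fun i => ⟨z i, Algebra.subset_adjoin ⟨Sum.inl i, rfl⟩⟩
  let yR : ι → R := fun i => ⟨(y i : K), Algebra.subset_adjoin ⟨Sum.inr i, rfl⟩⟩
  set J : Ideal R := Ideal.span (Set.range zR) with hJ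
  apply le_antisymm
  swap
  · -- `(z) ⊆ centre`
    rw [Ideal.span_le]
    rintro _ ⟨i, rfl⟩
    exact (hmem _).mpr (hz1 i)
  · intro r hr
    -- a presentation `r = P(z, y)`
    have hrange : (r : K) ∈ (MvPolynomial.aeval (Sum.elim z fun i => (y i : K)) :
        MvPolynomial (Fin N ⊕ ι) k →ₐ[k] K).range := by
      rw [← Algebra.adjoin_range_eq_range_aeval]
      exact r.2
    obtain ⟨P, hP⟩ := hrange
    have hfun : (fun s => R.val (Sum.elim zR yR s)) = Sum.elim z fun i => (y i : K) := by
      funext s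
      rcases s with i | i <;> rfl
    have hwR : ∀ Q : MvPolynomial (Fin N ⊕ ι) k,
        ((MvPolynomial.aeval (Sum.elim zR yR) Q : R) : K) =
          MvPolynomial.aeval (Sum.elim z fun i => (y i : K)) Q := fun Q => by
      rw [show ((MvPolynomial.aeval (Sum.elim zR yR) Q : R) : K) =
          R.val (MvPolynomial.aeval (Sum.elim zR yR) Q) from rfl, MvPolynomial.comp_aeval_apply,
        hfun]
    have hrP : r = MvPolynomial.aeval (Sum.elim zR yR) P := Subtype.ext (by
      rw [hwR]
      exact hP.symm)
    -- substituting `z := 0` changes `P(z, y)` by an element of `(z)`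
    have hdiff : ∀ Q : MvPolynomial (Fin N ⊕ ι) k,
        MvPolynomial.aeval (Sum.elim zR yR) Q - MvPolynomial.aeval (Sum.elim 0 yR) Q ∈ J := by
      intro Q
      induction Q using MvPolynomial.induction_on with
      | C c => rw [MvPolynomial.aeval_C, MvPolynomial.aeval_C, sub_self]; exact J.zero_mem
      | add P₁ P₂ h₁ h₂ =>
        rw [map_add, map_add, add_sub_add_comm]
        exact J.add_mem h₁ h₂
      | mul_X Q s hQ =>
        rw [map_mul, map_mul, MvPolynomial.aeval_X, MvPolynomial.aeval_X]
        rcases s with i | i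
        · rw [Sum.elim_inl, Sum.elim_inl, Pi.zero_apply, mul_zero, sub_zero]
          exact J.mul_mem_left _ (Ideal.subset_span ⟨i, rfl⟩)
        · rw [Sum.elim_inr, Sum.elim_inr, ← sub_mul]
          exact J.mul_mem_right _ hQ
    -- the constant part `P(0, y) ∈ k[y]` lies in the centre, hence vanishes
    set a₀ : R := MvPolynomial.aeval (Sum.elim 0 yR) P with ha₀
    have ha₀mem : a₀ ∈ centreIdeal R O hRO := by
      have h1 : r - (r - a₀) = a₀ := sub_sub_cancel r a₀
      rw [← h1]
      refine Ideal.sub_mem _ hr ?_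
      have hJle : J ≤ centreIdeal R O hRO := by
        rw [hJ, Ideal.span_le]
        rintro _ ⟨i, rfl⟩
        exact (hmem _).mpr (hz1 i)
      exact hJle (hrP ▸ hdiff P)
    have ha₀K : (a₀ : K) ∈ Algebra.adjoin k (Set.range fun i => (y i : K)) := by
      have hfun0 : (fun s => R.val (Sum.elim (0 : Fin N → R) yR s)) =
          Sum.elim (0 : Fin N → K) fun i => (y i : K) := by
        funext s
        rcases s with i | i <;> rfl
      have h1 : (a₀ : K) = MvPolynomial.aeval (Sum.elim (0 : Fin N → K) fun i => (y i : K)) P := by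
        rw [ha₀, show ((MvPolynomial.aeval (Sum.elim 0 yR) P : R) : K) =
          R.val (MvPolynomial.aeval (Sum.elim 0 yR) P) from rfl, MvPolynomial.comp_aeval_apply,
          hfun0]
      rw [h1]
      have hle : Algebra.adjoin k (Set.range (Sum.elim (0 : Fin N → K) fun i => (y i : K))) ≤
          Algebra.adjoin k (Set.range fun i => (y i : K)) := by
        refine Algebra.adjoin_le ?_
        rintro _ ⟨s, rfl⟩
        rcases s with i | i
        · exact Subalgebra.zero_mem _
        · exact Algebra.subset_adjoin ⟨i, rfl⟩
      refine hle ?_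
      rw [Algebra.adjoin_range_eq_range_aeval]
      exact ⟨P, rfl⟩
    have ha₀0 : a₀ = 0 := by
      by_contra hne
      have hne' : (a₀ : K) ≠ 0 := fun h => hne (Subtype.ext h)
      have h1 : O.valuation (a₀ : K) = 1 := valuation_eq_one_of_mem_adjoin O y hy ha₀K hne'
      have h2 : O.valuation (a₀ : K) < 1 := (hmem _).mp ha₀mem
      rw [h1] at h2
      exact lt_irrefl _ h2
    have hfinal : r = (r - a₀) + a₀ := (sub_add_cancel r a₀).symm
    rw [hfinal]
    refine J.add_mem ?_ (by rw [ha₀0]; exact J.zero_mem)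
    rw [hrP]
    exact hdiff P

end Centre

/-! ### The fundamental inequality, value part: `[Γ_K : Γ_F] ≤ [K : F]` -/

section Index

/-- **Fundamental inequality, value part** (classical; "an easy classical result states that
`ef ≤ n`", Temkin 2013, §2.1, p. 9): let `F ⊆ K` be a subfield over which `K` is finite and
`H` a subgroup of the value group of `K` containing the values of `F^×`. Non-zero elements of
`K` whose values lie in pairwise distinct cosets modulo `H` are `F`-linearly independent, so
there are at most `[K : F]` of them. PROVED (ultrametric inequality).
[cite: Temkin2013, Section 2.1 (p. 9)] -/
theorem card_le_finrank_of_pairwise_notMem (F : IntermediateField k K) [FiniteDimensional F K]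
    (H : Subgroup (ValuationSubring.ValueGroup O)ˣ)
    (hH : ∀ c : K, c ∈ F → (hc : c ≠ 0) →
      Units.mk0 (O.valuation c) (valuation_ne_zero_of_ne_zero O hc) ∈ H)
    {m : ℕ} (a : Fin m → K) (ha0 : ∀ i, a i ≠ 0)
    (hdist : ∀ i j, i ≠ j →
      (Units.mk0 (O.valuation (a i)) (valuation_ne_zero_of_ne_zero O (ha0 i)))⁻¹ *
        Units.mk0 (O.valuation (a j)) (valuation_ne_zero_of_ne_zero O (ha0 j)) ∉ H) :
    m ≤ Module.finrank F K := by
  classical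
  have hli : LinearIndependent F a := by
    rw [Fintype.linearIndependent_iff]
    intro g hsum i
    by_contra hgi
    let s : Finset (Fin m) := Finset.univ.filter fun j => g j ≠ 0
    have hi : i ∈ s := Finset.mem_filter.mpr ⟨Finset.mem_univ _, hgi⟩
    have hsum' : ∑ j ∈ s, (g j : K) * a j = 0 := by
      calc ∑ j ∈ s, (g j : K) * a j = ∑ j, g j • a j := by
            rw [Finset.sum_filter]
            refine Finset.sum_congr rfl fun j _ => ?_
            split_ifs with h
            · rfl
            · rw [not_not.mp h, zero_smul]
        _ = 0 := hsum
    obtain ⟨j₀, hj₀, hmax⟩ :=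
      s.exists_max_image (fun j => O.valuation ((g j : K) * a j)) ⟨i, hi⟩
    have hg0 : ∀ j ∈ s, ((g j : F) : K) ≠ 0 := fun j hj => by
      have h := (Finset.mem_filter.mp hj).2
      exact fun h' => h (by exact_mod_cast h')
    have hlt : ∀ j ∈ s \ {j₀},
        O.valuation ((g j : K) * a j) < O.valuation ((g j₀ : K) * a j₀) := by
      intro j hj
      obtain ⟨hjs, hne⟩ := Finset.mem_sdiff.mp hj
      rw [Finset.mem_singleton] at hne
      refine lt_of_le_of_ne (hmax j hjs) fun heq => hdist j j₀ hne ?_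
      have hcj := hH _ (g j).2 (hg0 j hjs)
      have hcj₀ := hH _ (g j₀).2 (hg0 j₀ hj₀)
      have h2 : Units.mk0 (O.valuation ((g j : F) : K)) (valuation_ne_zero_of_ne_zero O (hg0 j hjs)) *
          Units.mk0 (O.valuation (a j)) (valuation_ne_zero_of_ne_zero O (ha0 j)) =
          Units.mk0 (O.valuation ((g j₀ : F) : K)) (valuation_ne_zero_of_ne_zero O (hg0 j₀ hj₀)) *
            Units.mk0 (O.valuation (a j₀)) (valuation_ne_zero_of_ne_zero O (ha0 j₀)) :=
        Units.ext (by simpa only [Units.val_mul, Units.val_mk0, map_mul] using heq)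
      have h3 : (Units.mk0 (O.valuation (a j)) (valuation_ne_zero_of_ne_zero O (ha0 j)))⁻¹ *
          Units.mk0 (O.valuation (a j₀)) (valuation_ne_zero_of_ne_zero O (ha0 j₀)) =
          Units.mk0 (O.valuation ((g j : F) : K)) (valuation_ne_zero_of_ne_zero O (hg0 j hjs)) *
            (Units.mk0 (O.valuation ((g j₀ : F) : K))
              (valuation_ne_zero_of_ne_zero O (hg0 j₀ hj₀)))⁻¹ := by
        rw [inv_mul_eq_iff_eq_mul, ← mul_assoc, eq_mul_inv_iff_mul_eq, mul_comm _ (Units.mk0 _ _),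
          mul_comm (Units.mk0 (O.valuation (a j)) _)]
        exact h2.symm
      rw [h3]
      exact H.mul_mem hcj (H.inv_mem hcj₀)
    have hv := O.valuation.map_sum_eq_of_lt hj₀ hlt
    rw [hsum', map_zero] at hv
    exact (mul_ne_zero (hg0 j₀ hj₀) (ha0 j₀)) ((map_eq_zero O.valuation).mp hv.symm)
  simpa using hli.fintype_card_le_finrank

/-- Hence the values of `F^×` generate a subgroup of FINITE INDEX, at most `[K : F]`, in the value
group of `K` ("`e ≤ n`"). PROVED. [cite: Temkin2013, Section 2.1 (p. 9)] -/
theorem finiteIndex_of_forall_mk0_valuation_mem (F : IntermediateField k K) [FiniteDimensional F K]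
    (H : Subgroup (ValuationSubring.ValueGroup O)ˣ)
    (hH : ∀ c : K, c ∈ F → (hc : c ≠ 0) →
      Units.mk0 (O.valuation c) (valuation_ne_zero_of_ne_zero O hc) ∈ H) :
    H.FiniteIndex ∧ H.index ≤ Module.finrank F K := by
  classical
  -- any injective family of cosets has at most `[K : F]` members
  have key : ∀ (m : ℕ) (c : Fin m → (ValuationSubring.ValueGroup O)ˣ ⧸ H),
      Function.Injective c → m ≤ Module.finrank F K := by
    intro m c hc
    choose a ha using fun i =>
      O.valuation_surjective (((c i).out : (ValuationSubring.ValueGroup O)ˣ) :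
        ValuationSubring.ValueGroup O)
    have ha0 : ∀ i, a i ≠ 0 := fun i h => by
      have h1 := ha i
      rw [h, map_zero] at h1
      exact (c i).out.ne_zero h1.symm
    have hmk : ∀ i, Units.mk0 (O.valuation (a i)) (valuation_ne_zero_of_ne_zero O (ha0 i)) =
        (c i).out := fun i => Units.ext (ha i)
    refine card_le_finrank_of_pairwise_notMem O F H hH a ha0 fun i j hij hmem => hij (hc ?_)
    rw [hmk, hmk] at hmem
    rw [← QuotientGroup.out_eq' (c i), ← QuotientGroup.out_eq' (c j)]
    exact QuotientGroup.eq.mpr hmem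
  have hfin : Finite ((ValuationSubring.ValueGroup O)ˣ ⧸ H) := by
    by_contra hinf
    rw [not_finite_iff_infinite] at hinf
    obtain ⟨s, hs⟩ := Infinite.exists_subset_card_eq ((ValuationSubring.ValueGroup O)ˣ ⧸ H)
      (Module.finrank F K + 1)
    have h := key (Module.finrank F K + 1)
      (fun i => ((s.equivFin.symm (Fin.cast hs.symm i) : ↥s) : _ ⧸ H))
      (Subtype.val_injective.comp (s.equivFin.symm.injective.comp (Fin.cast_injective _)))
    omega
  haveI := hfin
  refine ⟨Subgroup.finiteIndex_of_finite_quotient, ?_⟩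
  haveI := Fintype.ofFinite ((ValuationSubring.ValueGroup O)ˣ ⧸ H)
  rw [Subgroup.index, Nat.card_eq_fintype_card]
  exact key _ (fun i => (Fintype.equivFin _).symm i) (Equiv.injective _)

end Index

/-! ### Temkin's Remark 2.1.3: the value group of a finitely generated Abhyankar `K/k` -/

section Abhyankar

variable [Algebra k O] [IsScalarTower k O K] {ι κ : Type*} [Fintype ι] [Fintype κ]
  (y : ι → O) (x : κ → K)

/-- `K` is finite over `k(B)` for an Abhyankar TRANSCENDENCE basis `B` of a finitely generated
`K/k`. [folklore] -/
theorem finiteDimensional_adjoin_of_isTranscendenceBasis (hfg : (⊤ : IntermediateField k K).FG)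
    {τ : Type*} (w : τ → K) (hw : IsTranscendenceBasis k w) :
    FiniteDimensional (IntermediateField.adjoin k (Set.range w)) K := by
  classical
  haveI : Algebra.IsAlgebraic (IntermediateField.adjoin k (Set.range w)) K := hw.isAlgebraic_field
  obtain ⟨S, hS⟩ := hfg
  set F := IntermediateField.adjoin k (Set.range w)
  have htop : IntermediateField.adjoin F (S : Set K) = ⊤ := by
    refine eq_top_iff.mpr fun t _ => ?_
    have ht : t ∈ IntermediateField.adjoin k (S : Set K) := by rw [hS]; trivial
    have hle : IntermediateField.adjoin k (S : Set K) ≤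
        (IntermediateField.adjoin F (S : Set K)).restrictScalars k :=
      IntermediateField.adjoin_le_iff.mpr (IntermediateField.subset_adjoin F (S : Set K))
    exact hle ht
  haveI : FiniteDimensional F (IntermediateField.adjoin F (S : Set K)) :=
    IntermediateField.finiteDimensional_adjoin fun t _ =>
      (Algebra.IsAlgebraic.isAlgebraic (R := F) t).isIntegral
  rw [htop] at this
  exact LinearEquiv.finiteDimensional (IntermediateField.topEquiv (F := F) (E := K)).toLinearEquiv

omit [Fintype ι] in
/-- **Temkin 2013, Remark 2.1.3 (value group), for an Abhyankar system**: if `B = x ⊔ y` is an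
Abhyankar system of `K°` over the trivially valued `k` which is a transcendence basis of the
finitely generated `K/k`, then the values `|xⱼ|` generate a subgroup of finite index
`≤ [K : k(B)]` of `|K^×|`, and `|K^×|` is a finitely generated group. PROVED (`|k(B)^×| = Λ_B`
and the value part of the fundamental inequality for `K/k(B)`).
[cite: Temkin2013, Remark 2.1.3 (p. 10 of arXiv:0804.1554v3)] -/
theorem valueGroup_fg_of_isTranscendenceBasis (hfg : (⊤ : IntermediateField k K).FG)
    (hy : AlgebraicIndependent k fun i => residue O (y i)) (hx0 : ∀ j, x j ≠ 0)
    (hx : LinearIndependent ℤ fun j =>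
      Additive.ofMul (Units.mk0 (O.valuation (x j)) (valuation_ne_zero_of_ne_zero O (hx0 j))))
    (hB : IsTranscendenceBasis k (Sum.elim x fun i => (y i : K))) :
    (Subgroup.closure (Set.range fun j =>
        Units.mk0 (O.valuation (x j)) (valuation_ne_zero_of_ne_zero O (hx0 j)))).FiniteIndex ∧
      Group.FG (ValuationSubring.ValueGroup O)ˣ := by
  classical
  haveI := finiteDimensional_adjoin_of_isTranscendenceBasis hfg _ hB
  set H : Subgroup (ValuationSubring.ValueGroup O)ˣ := Subgroup.closure (Set.range fun j =>
    Units.mk0 (O.valuation (x j)) (valuation_ne_zero_of_ne_zero O (hx0 j))) with hHdef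
  have hH : ∀ c : K, c ∈ IntermediateField.adjoin k (Set.range (Sum.elim x fun i => (y i : K))) →
      (hc : c ≠ 0) → Units.mk0 (O.valuation c) (valuation_ne_zero_of_ne_zero O hc) ∈ H := by
    intro c hc hc0
    rw [Set.Sum.elim_range, Set.union_comm] at hc
    exact mk0_valuation_mem_closure_of_mem_adjoin O y x hy hx0 hx hc hc0
  obtain ⟨hfi, -⟩ := finiteIndex_of_forall_mk0_valuation_mem O _ H hH
  haveI := hfi
  refine ⟨hfi, group_fg_of_fg_of_finiteIndex H ⟨(Set.finite_range fun j =>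
    Units.mk0 (O.valuation (x j)) (valuation_ne_zero_of_ne_zero O (hx0 j))).toFinset, ?_⟩⟩
  rw [Set.Finite.coe_toFinset]

/-- Lifting a basis of `Γ_O ⊗ ℚ`: if `E = ratRank O` is a natural number `e`, there are `e`
non-zero elements of `K` with `ℤ`-independent values. [folklore] -/
theorem exists_linearIndependent_valuation_of_ratRank_eq (e : ℕ) (he : ratRank O = e) :
    ∃ (x : Fin e → K) (hx0 : ∀ j, x j ≠ 0), LinearIndependent ℤ fun j =>
      Additive.ofMul (Units.mk0 (O.valuation (x j)) (valuation_ne_zero_of_ne_zero O (hx0 j))) := by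
  obtain ⟨u, hu⟩ := exists_linearIndependent_of_le_rank (R := ℤ)
    (M := Additive (ValuationSubring.ValueGroup O)ˣ) (n := e) (by rw [← ratRank, he])
  choose x hx using fun j => O.valuation_surjective
    ((Additive.toMul (u j) : (ValuationSubring.ValueGroup O)ˣ) : ValuationSubring.ValueGroup O)
  have hx0 : ∀ j, x j ≠ 0 := fun j h => by
    have h1 := hx j
    rw [h, map_zero] at h1
    exact (Additive.toMul (u j)).ne_zero h1.symm
  refine ⟨x, hx0, ?_⟩
  have heq : (fun j => Additive.ofMul (Units.mk0 (O.valuation (x j))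
      (valuation_ne_zero_of_ne_zero O (hx0 j)))) = u := by
    funext j
    have : Units.mk0 (O.valuation (x j)) (valuation_ne_zero_of_ne_zero O (hx0 j)) =
        Additive.toMul (u j) := Units.ext (hx j)
    rw [this]
    rfl
  rw [heq]
  exact hu

omit [Algebra k O] [IsScalarTower k O K] in
/-- **Temkin 2013, Remark 2.1.3 (value group)** ("Let `l/k` be a finitely generated Abhyankar
extension. Then one easily sees that `l̃` is a finitely generated extension of `k̃` of
transcendence degree `F` and `|l^×|/|k^×|` is a finitely generated group whose torsion is
contained in `(|k^×| ⊗_ℤ ℚ)/|k^×|`. In particular, if `|k^×|` is divisible (for example, trivial)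
then `|l^×|/|k^×|` is a lattice of rank `E`"), the value-group half, for a trivially valued ground
field: if `K/k` is finitely generated, `k ⊆ K°` and the transcendence defect `D_{K/k}` vanishes,
then the value group `|K^×|` is a finitely generated group — hence (being torsion-free, as an
ordered group) a lattice, of rank `E` by the definition of `ratRank`; see
`valueGroup_lattice_of_transcendenceDefect_eq_zero`. (The residue-field half is not treated
in this file.) PROVED. [cite: Temkin2013, Remark 2.1.3 (p. 10 of arXiv:0804.1554v3)] -/
theorem valueGroup_fg_of_transcendenceDefect_eq_zero (hfg : (⊤ : IntermediateField k K).FG)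
    (hk : ∀ c : k, algebraMap k K c ∈ O) (hD : transcendenceDefect k O hk = 0) :
    Group.FG (ValuationSubring.ValueGroup O)ˣ := by
  classical
  letI := algebraOfMem k O hk
  haveI := isScalarTower_algebraOfMem k O hk
  have hN : Algebra.trdeg k K < ℵ₀ := trdeg_lt_aleph0_of_fg hfg
  obtain ⟨N, hNn⟩ := Cardinal.lt_aleph0.mp hN
  obtain ⟨E, hE⟩ := Cardinal.lt_aleph0.mp (ratRank_lt_aleph0 O hk hN)
  obtain ⟨F, hF⟩ := Cardinal.lt_aleph0.mp (residueTrdeg_lt_aleph0 O hk hN)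
  have hsum : E + F = N := by
    have h := (transcendenceDefect_eq_zero_iff O hk hN).mp hD
    rw [hE, hF, hNn] at h
    exact_mod_cast h
  obtain ⟨y, hy⟩ := exists_algebraicIndependent_residue_of_residueTrdeg_eq O hk F hF
  obtain ⟨x, hx0, hx⟩ := exists_linearIndependent_valuation_of_ratRank_eq O E hE
  have hBind : AlgebraicIndependent k (Sum.elim x fun i => (y i : K)) :=
    algebraicIndependent_sumElim_of_valuation O y hy x (injective_valuation_prod_pow O x hx0 hx)
  have hcard : Cardinal.lift.{0} (Algebra.trdeg k K) ≤ Cardinal.lift.{u} #(Fin E ⊕ Fin F) := by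
    rw [hNn]
    simp only [Cardinal.mk_sum, Cardinal.mk_fin, Cardinal.lift_natCast, Cardinal.lift_add]
    exact_mod_cast hsum.ge
  have hB : IsTranscendenceBasis k (Sum.elim x fun i => (y i : K)) :=
    hBind.isTranscendenceBasis_of_lift_trdeg_le_of_finite hcard
  exact (valueGroup_fg_of_isTranscendenceBasis O y x hfg hy hx0 hx hB).2

omit [Algebra k O] [IsScalarTower k O K] in
/-- **Temkin 2013, Remark 2.1.3: `|K^×|` is a lattice of rank `E`** for a finitely generated
`K/k` with `k ⊆ K°` and `D_{K/k} = 0`: the value group, written additively, is a finitely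
generated free `ℤ`-module whose rank is the rational rank `E = ratRank O`. PROVED.
[cite: Temkin2013, Remark 2.1.3 (p. 10 of arXiv:0804.1554v3)] -/
theorem valueGroup_lattice_of_transcendenceDefect_eq_zero (hfg : (⊤ : IntermediateField k K).FG)
    (hk : ∀ c : k, algebraMap k K c ∈ O) (hD : transcendenceDefect k O hk = 0) :
    Module.Finite ℤ (Additive (ValuationSubring.ValueGroup O)ˣ) ∧
      Module.Free ℤ (Additive (ValuationSubring.ValueGroup O)ˣ) ∧
      (Module.finrank ℤ (Additive (ValuationSubring.ValueGroup O)ˣ) : Cardinal) = ratRank O := by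
  haveI : Group.FG (ValuationSubring.ValueGroup O)ˣ :=
    valueGroup_fg_of_transcendenceDefect_eq_zero O hfg hk hD
  haveI : Module.Finite ℤ (Additive (ValuationSubring.ValueGroup O)ˣ) :=
    Module.Finite.iff_addGroup_fg.mpr inferInstance
  haveI : Module.Free ℤ (Additive (ValuationSubring.ValueGroup O)ˣ) :=
    Module.free_of_finite_type_torsion_free'
  exact ⟨inferInstance, inferInstance, Module.finrank_eq_rank ℤ _⟩

/-! ### Temkin's Remark 2.1.3: the residue field of a finitely generated Abhyankar `K/k` -/

omit [Fintype ι] in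
/-- **Residues on a toric chart**: for `z` of values `< 1` and `y ∈ K°`, the residue of any
element of `k[z, y] ⊆ K°` lies in `k[ȳ]`, the `k`-subalgebra of the residue field generated by the
residues of the `yᵢ` (the `zᵢ` reduce to `0`). [folklore] -/
theorem residue_mem_adjoin_of_mem_chart {N : ℕ} (z : Fin N → K) (hz1 : ∀ i, O.valuation (z i) < 1)
    (hRO : (Algebra.adjoin k (Set.range (Sum.elim z fun i => (y i : K)))).toSubring ≤ O.toSubring)
    {p : K} (hp : p ∈ Algebra.adjoin k (Set.range (Sum.elim z fun i => (y i : K)))) :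
    residue O ⟨p, hRO hp⟩ ∈ Algebra.adjoin k (Set.range fun i => residue O (y i)) := by
  refine Algebra.adjoin_induction (p := fun q hq => residue O ⟨q, hRO hq⟩ ∈
      Algebra.adjoin k (Set.range fun i => residue O (y i))) ?_ ?_ ?_ ?_ hp
  · rintro _ ⟨s, rfl⟩
    rcases s with i | i
    · have h0 : residue O ⟨Sum.elim z (fun i => (y i : K)) (Sum.inl i),
          hRO (Algebra.subset_adjoin ⟨Sum.inl i, rfl⟩)⟩ = 0 := by
        rw [residue_eq_zero_iff]
        exact (ValuationSubring.valuation_lt_one_iff O _).mpr (hz1 i)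
      rw [h0]
      exact Subalgebra.zero_mem _
    · have h1 : (⟨Sum.elim z (fun i => (y i : K)) (Sum.inr i),
          hRO (Algebra.subset_adjoin ⟨Sum.inr i, rfl⟩)⟩ : O) = y i := Subtype.ext rfl
      rw [h1]
      exact Algebra.subset_adjoin ⟨i, rfl⟩
  · intro c
    have h1 : (⟨algebraMap k K c, hRO (Subalgebra.algebraMap_mem _ c)⟩ : O) = algebraMap k O c :=
      Subtype.ext (IsScalarTower.algebraMap_apply k O K c)
    rw [h1]
    have h2 : algebraMap k (ResidueField O) c = residue O (algebraMap k O c) :=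
      IsScalarTower.algebraMap_apply k O (ResidueField O) c
    rw [← h2]
    exact Subalgebra.algebraMap_mem _ c
  · intro a b ha hb iha ihb
    have h1 : (⟨a + b, hRO (add_mem ha hb)⟩ : O) = ⟨a, hRO ha⟩ + ⟨b, hRO hb⟩ := Subtype.ext rfl
    rw [h1, map_add]
    exact add_mem iha ihb
  · intro a b ha hb iha ihb
    have h1 : (⟨a * b, hRO (mul_mem ha hb)⟩ : O) = ⟨a, hRO ha⟩ * ⟨b, hRO hb⟩ := Subtype.ext rfl
    rw [h1, map_mul]
    exact mul_mem iha ihb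

/-- **`(K_B)~ = k(B̃_F)`** (the residue field of the Gauss valuation on `k(B)`; Knaf–Kuhlmann
2005, Thm. 2.1: "`K(x, y)P = KP(yP)`"; implicit in Temkin 2013, §5.3 and Remark 2.1.3): for an
Abhyankar system `B = x ⊔ y` over the trivially valued `k`, the residue of every element of
`k(B) ∩ K°` lies in `k(ȳ)`. PROVED (a toric chart containing the element, `exists_toricChart`:
the element is `p/q` with `p, q ∈ k[z, y]`, `|q| = 1`, and `k[z, y]` reduces into `k[ȳ]`).
[cite: KnafKuhlmann2005, Thm. 2.1] -/
theorem residue_mem_adjoin_of_mem_adjoin (hy : AlgebraicIndependent k fun i => residue O (y i))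
    (hx0 : ∀ j, x j ≠ 0)
    (hx : LinearIndependent ℤ fun j =>
      Additive.ofMul (Units.mk0 (O.valuation (x j)) (valuation_ne_zero_of_ne_zero O (hx0 j))))
    {t : K} (ht : t ∈ IntermediateField.adjoin k ((Set.range fun i => (y i : K)) ∪ Set.range x))
    (htO : t ∈ O) :
    residue O ⟨t, htO⟩ ∈ IntermediateField.adjoin k (Set.range fun i => residue O (y i)) := by
  classical
  obtain ⟨N, z, hRO, -, hz1, -, -, -, hfrac⟩ :=
    exists_regular_toricChart O y x hy hx0 hx (fun _ : Unit => t) (fun _ => ht) (fun _ => htO)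
  obtain ⟨p, q, hp, hq, hq1, htpq⟩ := hfrac ()
  have hq0 : q ≠ 0 := fun h => by
    rw [h, map_zero] at hq1
    exact zero_ne_one hq1
  have hpO : p ∈ O := hRO hp
  have hqO : q ∈ O := hRO hq
  have hresq : residue O ⟨q, hqO⟩ ≠ 0 := by
    rw [Ne, residue_eq_zero_iff]
    intro hmem
    have := (ValuationSubring.valuation_lt_one_iff O _).mp hmem
    rw [hq1] at this
    exact lt_irrefl _ this
  have hmul : (⟨t, htO⟩ : O) * ⟨q, hqO⟩ = ⟨p, hpO⟩ := Subtype.ext (by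
    change t * q = p
    rw [htpq, div_mul_cancel₀ p hq0])
  have hres : residue O ⟨t, htO⟩ = residue O ⟨p, hpO⟩ / residue O ⟨q, hqO⟩ := by
    rw [eq_div_iff hresq, ← map_mul, hmul]
  rw [hres]
  have hle : Algebra.adjoin k (Set.range fun i => residue O (y i)) ≤
      (IntermediateField.adjoin k (Set.range fun i => residue O (y i))).toSubalgebra :=
    IntermediateField.algebra_adjoin_le_adjoin _ _
  exact div_mem (hle (residue_mem_adjoin_of_mem_chart O y z hz1 hRO hp))
    (hle (residue_mem_adjoin_of_mem_chart O y z hz1 hRO hq))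

omit [IsScalarTower k O K] [Fintype ι] [Fintype κ] in
/-- **Fundamental inequality, residue part** (classical, "`ef ≤ n`", Temkin 2013, §2.1, p. 9):
let `F ⊆ K` be a subfield over which `K` is finite and `L` a subfield of the residue field `K̃`
containing the residues of `F ∩ K°`. Elements of `K°` whose residues are `L`-linearly independent
are `F`-linearly independent, so there are at most `[K : F]` of them. PROVED (normalise a linear
relation by a coefficient of maximal value and reduce). [cite: Temkin2013, Section 2.1 (p. 9)] -/
theorem card_le_finrank_of_residue_linearIndependent' (F : IntermediateField k K)
    [FiniteDimensional F K] (L : IntermediateField k (ResidueField O))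
    (hL : ∀ c : K, c ∈ F → (hc : c ∈ O) → residue O ⟨c, hc⟩ ∈ L)
    {m : ℕ} (r : Fin m → O) (hr : LinearIndependent L fun i => residue O (r i)) :
    m ≤ Module.finrank F K := by
  classical
  have hli : LinearIndependent F (fun i => (r i : K)) := by
    rw [Fintype.linearIndependent_iff]
    intro g hsum
    by_contra hne
    push Not at hne
    obtain ⟨i, hgi⟩ := hne
    obtain ⟨j₀, -, hmax⟩ :=
      Finset.univ.exists_max_image (fun j => O.valuation (g j : K)) ⟨i, Finset.mem_univ _⟩
    have hc0 : ((g j₀ : F) : K) ≠ 0 := by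
      intro h0
      have h1 : O.valuation (g i : K) ≤ O.valuation (g j₀ : K) := hmax i (Finset.mem_univ _)
      rw [h0, map_zero, le_zero_iff, map_eq_zero] at h1
      exact hgi (by exact_mod_cast h1)
    have hvc0 : O.valuation (g j₀ : K) ≠ 0 := (Valuation.ne_zero_iff _).mpr hc0
    have hgO : ∀ j, ((g j : F) : K) / (g j₀ : K) ∈ O := fun j => by
      refine (O.valuation_le_one_iff _).mp ?_
      rw [map_div₀]
      exact (div_le_one₀ (zero_lt_iff.mpr hvc0)).mpr (hmax j (Finset.mem_univ _))
    -- the normalised relation, in `K`, in `K°`, and reduced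
    have hrelK : ∑ j, ((g j : F) : K) / (g j₀ : K) * (r j : K) = 0 := by
      have h0 : ∑ j, ((g j : F) : K) * (r j : K) = 0 := by
        rw [← hsum]
        exact Finset.sum_congr rfl fun j _ => rfl
      have h1 : ∑ j, ((g j : F) : K) / (g j₀ : K) * (r j : K) =
          (∑ j, ((g j : F) : K) * (r j : K)) * ((g j₀ : F) : K)⁻¹ := by
        rw [Finset.sum_mul]
        exact Finset.sum_congr rfl fun j _ => by ring
      rw [h1, h0, zero_mul]
    have hrelO : ∑ j, (⟨((g j : F) : K) / (g j₀ : K), hgO j⟩ : O) * r j = 0 := by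
      apply Subtype.ext
      rw [AddSubmonoidClass.coe_finsetSum]
      exact hrelK
    have hres := congrArg (residue O) hrelO
    rw [map_sum, map_zero] at hres
    simp only [map_mul] at hres
    let l : Fin m → L := fun j => ⟨residue O ⟨((g j : F) : K) / (g j₀ : K), hgO j⟩,
      hL _ (div_mem (g j).2 (g j₀).2) (hgO j)⟩
    have hrel : ∑ j, l j • residue O (r j) = 0 := by
      rw [← hres]
      exact Finset.sum_congr rfl fun j _ => rfl
    have hl0 := (Fintype.linearIndependent_iff.mp hr) l hrel j₀
    have hl1 : l j₀ = 1 := Subtype.ext (by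
      change residue O ⟨((g j₀ : F) : K) / (g j₀ : K), _⟩ = 1
      have h1 : (⟨((g j₀ : F) : K) / (g j₀ : K), hgO j₀⟩ : O) = 1 := Subtype.ext (div_self hc0)
      rw [h1, map_one])
    rw [hl1] at hl0
    exact one_ne_zero hl0
  simpa using hli.fintype_card_le_finrank

/-- **Temkin 2013, Remark 2.1.3 (residue field), for an Abhyankar system**: if `B = x ⊔ y` is an
Abhyankar system of `K°` over the trivially valued `k` which is a transcendence basis of the
finitely generated `K/k`, then the residue field `K̃` is finite over `k(ȳ)` (of degree
`≤ [K : k(B)]`) and finitely generated over `k`. PROVED (`(K_B)~ = k(ȳ)` and the residue part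
of the fundamental inequality). [cite: Temkin2013, Remark 2.1.3 (p. 10 of arXiv:0804.1554v3)] -/
theorem residueField_fg_of_isTranscendenceBasis (hfg : (⊤ : IntermediateField k K).FG)
    (hy : AlgebraicIndependent k fun i => residue O (y i)) (hx0 : ∀ j, x j ≠ 0)
    (hx : LinearIndependent ℤ fun j =>
      Additive.ofMul (Units.mk0 (O.valuation (x j)) (valuation_ne_zero_of_ne_zero O (hx0 j))))
    (hB : IsTranscendenceBasis k (Sum.elim x fun i => (y i : K))) :
    Module.Finite (IntermediateField.adjoin k (Set.range fun i => residue O (y i)))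
        (ResidueField O) ∧
      (⊤ : IntermediateField k (ResidueField O)).FG := by
  classical
  haveI := finiteDimensional_adjoin_of_isTranscendenceBasis hfg _ hB
  have hL : ∀ c : K, c ∈ IntermediateField.adjoin k (Set.range (Sum.elim x fun i => (y i : K))) →
      (hc : c ∈ O) → residue O ⟨c, hc⟩ ∈
        IntermediateField.adjoin k (Set.range fun i => residue O (y i)) := by
    intro c hc hcO
    rw [Set.Sum.elim_range, Set.union_comm] at hc
    exact residue_mem_adjoin_of_mem_adjoin O y x hy hx0 hx hc hcO
  have hrank : Module.rank (IntermediateField.adjoin k (Set.range fun i => residue O (y i)))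
      (ResidueField O) ≤ Module.finrank
        (IntermediateField.adjoin k (Set.range (Sum.elim x fun i => (y i : K)))) K := by
    refine rank_le fun s hs => ?_
    choose r hr using fun v : ↥s => IsLocalRing.residue_surjective (v : ResidueField O)
    have hli : LinearIndependent (IntermediateField.adjoin k (Set.range fun i => residue O (y i)))
        fun v : ↥s => residue O (r v) := by
      have heq : (fun v : ↥s => residue O (r v)) = fun v : ↥s => (v : ResidueField O) :=
        funext hr
      rw [heq]
      exact hs
    have h := card_le_finrank_of_residue_linearIndependent' O _ _ hL
      (fun i => r (s.equivFin.symm i)) (hli.comp _ s.equivFin.symm.injective)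
    exact h
  have hfin : Module.Finite (IntermediateField.adjoin k (Set.range fun i => residue O (y i)))
      (ResidueField O) := by
    rw [← Module.rank_lt_aleph0_iff]
    exact hrank.trans_lt (natCast_lt_aleph0)
  refine ⟨hfin, ?_⟩
  haveI := hfin
  let b := Module.finBasis (IntermediateField.adjoin k (Set.range fun i => residue O (y i)))
    (ResidueField O)
  refine ⟨(Set.finite_range fun i => residue O (y i)).toFinset ∪ (Set.finite_range b).toFinset, ?_⟩
  rw [Finset.coe_union, Set.Finite.coe_toFinset, Set.Finite.coe_toFinset]
  refine eq_top_iff.mpr fun t _ => ?_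
  have hLle : IntermediateField.adjoin k (Set.range fun i => residue O (y i)) ≤
      IntermediateField.adjoin k ((Set.range fun i => residue O (y i)) ∪ Set.range b) :=
    IntermediateField.adjoin.mono _ _ _ Set.subset_union_left
  rw [← b.sum_repr t]
  refine sum_mem fun i _ => ?_
  rw [Algebra.smul_def]
  exact mul_mem (hLle (b.repr t i).2) (IntermediateField.subset_adjoin _ _ (Or.inr ⟨i, rfl⟩))

omit [Algebra k O] [IsScalarTower k O K] in
/-- **Temkin 2013, Remark 2.1.3 (residue field)** ("`l̃` is a finitely generated extension of
`k̃` of transcendence degree `F`"), for a trivially valued ground field: if `K/k` is finitely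
generated, `k ⊆ K°` and `D_{K/k} = 0`, then the residue field `K̃` is finitely generated over
`k` (its transcendence degree is `F = residueTrdeg` by definition). PROVED.
[cite: Temkin2013, Remark 2.1.3 (p. 10 of arXiv:0804.1554v3)] -/
theorem residueField_fg_of_transcendenceDefect_eq_zero (hfg : (⊤ : IntermediateField k K).FG)
    (hk : ∀ c : k, algebraMap k K c ∈ O) (hD : transcendenceDefect k O hk = 0) :
    letI := algebraOfMem k O hk
    (⊤ : IntermediateField k (ResidueField O)).FG := by
  classical
  letI := algebraOfMem k O hk
  haveI := isScalarTower_algebraOfMem k O hk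
  have hN : Algebra.trdeg k K < ℵ₀ := trdeg_lt_aleph0_of_fg hfg
  obtain ⟨N, hNn⟩ := Cardinal.lt_aleph0.mp hN
  obtain ⟨E, hE⟩ := Cardinal.lt_aleph0.mp (ratRank_lt_aleph0 O hk hN)
  obtain ⟨F, hF⟩ := Cardinal.lt_aleph0.mp (residueTrdeg_lt_aleph0 O hk hN)
  have hsum : E + F = N := by
    have h := (transcendenceDefect_eq_zero_iff O hk hN).mp hD
    rw [hE, hF, hNn] at h
    exact_mod_cast h
  obtain ⟨y, hy⟩ := exists_algebraicIndependent_residue_of_residueTrdeg_eq O hk F hF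
  obtain ⟨x, hx0, hx⟩ := exists_linearIndependent_valuation_of_ratRank_eq O E hE
  have hBind : AlgebraicIndependent k (Sum.elim x fun i => (y i : K)) :=
    algebraicIndependent_sumElim_of_valuation O y hy x (injective_valuation_prod_pow O x hx0 hx)
  have hcard : Cardinal.lift.{0} (Algebra.trdeg k K) ≤ Cardinal.lift.{u} #(Fin E ⊕ Fin F) := by
    rw [hNn]
    simp only [Cardinal.mk_sum, Cardinal.mk_fin, Cardinal.lift_natCast, Cardinal.lift_add]
    exact_mod_cast hsum.ge
  have hB : IsTranscendenceBasis k (Sum.elim x fun i => (y i : K)) :=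
    hBind.isTranscendenceBasis_of_lift_trdeg_le_of_finite hcard
  exact (residueField_fg_of_isTranscendenceBasis O y x hfg hy hx0 hx hB).2

end Abhyankar

end Literature.AlgebraicGeometry.Resolution
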